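import Summits.AnomalousDissipation.AnomalousDissipation.Theorems.SolenoidalFractalHomogenisationRealisedQuasiStaticCellLawUpperSomeDrift
import Summits.AnomalousDissipation.AnomalousDissipation.Theorems.SolenoidalFractalHomogenisationRealisedQuasiStaticCellLawUpperSomeRecursion
import HarnessLib

/-!
# K2R `RealisedQuasiStaticCellLaw`, line `floquet-bloch`, stub `stub_upperSome`: one slot of the principal pair — cone
# invariant, log step with polarisation weights, interior bound, drift

Summits-side helper (everything proved; no definitions, no named facts; `--supports stmt-AnomalousDissipation-20446`).
The per-slot theorems `sector_slot_lower` / `sector_slot_cone` / `sector_slot_drift` and the one-step arithmetic of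
`cone_recursion`, combined at the Galerkin level (`upperSome_slot_step`): if at the start `a = pP + start j` of a slot the
fast energy is in the cone, `R(a) ≤ ηx(a)`, and `x(a) = ‖α_N(a)(ℓ)‖² > 0`, then at the end `b = a + τ_j` the cone holds and
`x(b) > 0`; `log x(b) ≥ log x(a) + (w^o log θ^o + w^i log θ^i) − βη` with the polarisation weights of `α_N(a)(ℓ)` in the frame
of the slot (two-point Jensen); `x(t) ≥ x(a)/2` inside the slot; and the drift bound
`‖e^{D₀τ_j}α_N(b)(ℓ) − α_N(a)(ℓ)‖ ≤ e^{D₀τ_j}Λ|g₁|(√2+γ)√(ηx(a))·τ_j`. Iterating over the slots of all periods is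
`…UpperSomeInvariant`. Energy LOWER-bound half of the K2R bracket; not anomalous dissipation.
-/

set_option linter.dupNamespace false -- layout D-0017: `AnomalousDissipation.AnomalousDissipation` repeats by design

noncomputable section

namespace Summit.AnomalousDissipation.AnomalousDissipation.Theorems.SolenoidalFractalHomogenisation.RealisedQuasiStaticCellLaw

open Set MeasureTheory Filter Topology Function Complex Matrix
open scoped InnerProductSpace ComplexConjugate Matrix BigOperators
open Literature.Analysis Literature.Analysis.FunctionSpaces Literature.Analysis.FunctionSpaces.Torus
open Literature.Analysis.FluidPDE Literature.Analysis.FluidPDE.LatticeShear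
open Summit.AnomalousDissipation.AnomalousDissipation.Theorems.SolenoidalFractalHomogenisation.PermissibleCarrier

variable {k₀ : ℕ}

set_option maxHeartbeats 800000 in -- three slot theorems instantiated in one statement
/-- **One slot of the principal pair.** See the module docstring. -/
theorem upperSome_slot_step (W : LatticeWord k₀) {n : ℕ} (hn : 0 < n) {κ : ℝ} (hκ : 0 < κ)
    (ℓ : Fin 3 → ℤ) (hℓn : 2 * ‖latticeVec ℓ‖ ≤ n) {w₀ : UnitAddTorus (Fin 3) → EuclideanSpace ℝ (Fin 3)}
    (hw₀ : FunctionSpaces.Torus.MemSobolev 1 (FunctionSpaces.EuclideanSpace.complexify ∘ w₀))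
    (hdiv : FunctionSpaces.Torus.IsWeaklyDivFree w₀) (hmean : FunctionSpaces.Torus.HasZeroMean w₀)
    (hsupp : ∀ k : Fin 3 → ℤ, ¬ ((∃ z : Fin 3 → ℤ, k = ℓ + (n:ℤ) • z) ∨ (∃ z : Fin 3 → ℤ, k = -ℓ + (n:ℤ) • z)) →
      UnitAddTorus.mFourierCoeff (FunctionSpaces.EuclideanSpace.complexify ∘ w₀) k = 0)
    {N : ℕ} (hBN : (Finset.univ.biUnion fun j : Fin k₀ =>
        ({(fun i => (W.phase j).m i * n), -(fun i => (W.phase j).m i * n)} : Finset (Fin 3 → ℤ))) ⊆ freqBall N)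
    {T : ℝ} (p : ℕ) (j : Fin k₀) (hT : (p : ℝ) * W.period + W.start j + (W.phase j).τ ≤ T)
    (hk : ∀ J : ℤ, ℓ + J • (fun i => (W.phase j).m i * (n : ℤ)) ∈ freqBall N → ℓ + J • (fun i => (W.phase j).m i * (n : ℤ)) ≠ 0)
    (hdisj : ∀ J J' : ℤ, ℓ + J • (fun i => (W.phase j).m i * (n : ℤ)) ≠ -(ℓ + J' • (fun i => (W.phase j).m i * (n : ℤ))))
    {ζr : Fin 3 → ℝ} (hζ1 : ζr ⬝ᵥ ζr = 1) (hζ0 : ζr ⬝ᵥ (fun i => ((ℓ i : ℤ) : ℝ)) = 0)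
    (hζK : ζr ⬝ᵥ (fun i => (((fun i => (W.phase j).m i * (n : ℤ)) i : ℤ) : ℝ)) = 0)
    {pf : ℤ → Fin 3 → ℝ}
    (hp : ∀ J : ℤ, pf J = (Real.sqrt ((fun i => (((ℓ + J • (fun i => (W.phase j).m i * (n : ℤ))) i : ℤ) : ℝ)) ⬝ᵥ
        (fun i => (((ℓ + J • (fun i => (W.phase j).m i * (n : ℤ))) i : ℤ) : ℝ))))⁻¹ • (fun i => (((ℓ + J • (fun i => (W.phase j).m i * (n : ℤ))) i : ℤ) : ℝ)) ⨯₃ ζr)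
    {Wset : Finset ℤ} (hW : ∀ J : ℤ, J ∈ Wset ↔ ℓ + J • (fun i => (W.phase j).m i * (n : ℤ)) ∈ freqBall N)
    (h0 : (0 : ℤ) ∈ Wset) (h1 : (1 : ℤ) ∈ Wset) (hm1 : (-1 : ℤ) ∈ Wset)
    (hs : ∀ J ∈ Wset, |pf J ⬝ᵥ pf (J + 1)| ≤ 1)
    (Λ Δ ε β σo σi g₁ γ : ℝ) (hΛ : Λ = κ * (4 * Real.pi ^ 2 * freqNormSq (fun i => (W.phase j).m i * (n : ℤ))))
    (hΔ0 : 0 < Δ) (hε : 0 ≤ ε) (hβ : 0 ≤ β)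
    (hgap : ∀ J ∈ Wset, J ≠ 0 → freqNormSq ℓ / freqNormSq (fun i => (W.phase j).m i * (n : ℤ)) + Δ ≤ freqNormSq (ℓ + J • (fun i => (W.phase j).m i * (n : ℤ))) / freqNormSq (fun i => (W.phase j).m i * (n : ℤ)))
    (hσo : σo = 1 / (freqNormSq (ℓ + (-1 : ℤ) • (fun i => (W.phase j).m i * (n : ℤ))) / freqNormSq (fun i => (W.phase j).m i * (n : ℤ)) - freqNormSq ℓ / freqNormSq (fun i => (W.phase j).m i * (n : ℤ))) +
        1 / (freqNormSq (ℓ + (1 : ℤ) • (fun i => (W.phase j).m i * (n : ℤ))) / freqNormSq (fun i => (W.phase j).m i * (n : ℤ)) - freqNormSq ℓ / freqNormSq (fun i => (W.phase j).m i * (n : ℤ))))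
    (hσi : σi = (pf (-1) ⬝ᵥ pf 0) ^ 2 / (freqNormSq (ℓ + (-1 : ℤ) • (fun i => (W.phase j).m i * (n : ℤ))) / freqNormSq (fun i => (W.phase j).m i * (n : ℤ)) - freqNormSq ℓ / freqNormSq (fun i => (W.phase j).m i * (n : ℤ))) +
        (pf 0 ⬝ᵥ pf 1) ^ 2 / (freqNormSq (ℓ + (1 : ℤ) • (fun i => (W.phase j).m i * (n : ℤ))) / freqNormSq (fun i => (W.phase j).m i * (n : ℤ)) - freqNormSq ℓ / freqNormSq (fun i => (W.phase j).m i * (n : ℤ))))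
    (hγ : γ ^ 2 = (pf 0 ⬝ᵥ pf 1) ^ 2 + (pf (-1) ⬝ᵥ pf 0) ^ 2) (hγ0 : 0 ≤ γ)
    (hg₁ : g₁ = 2 * Real.pi * (∑ i, (W.phase j).e i * (ℓ i : ℝ)) *
        ‖Complex.exp ((W.phase j).φ * Complex.I) *
          (1 / (2 * ((2 * Real.pi * ‖latticeVec (W.phase j).m‖ : ℝ) : ℂ) * Complex.I))‖ * (1 / (n : ℝ)) / Λ)
    (hβo : 2 ≤ β * Δ * ε * σo) (hβi : γ ^ 2 ≤ β * Δ * ε * σi)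
    (hsmallo : g₁ ^ 2 * (4 * 2 / Δ + 2 * (1 + ε) * σo) +
      2 * (4 * β * 2 * (Λ * |g₁| ^ 3 * σo + |g₁| / (W.ramp * (W.phase j).τ) + Λ * |g₁| ^ 2) ^ 2 / (Λ * Δ ^ 3)) / Λ ≤ Δ)
    (hsmalli : g₁ ^ 2 * (4 * γ ^ 2 / Δ + 2 * (1 + ε) * σi) +
      2 * (4 * β * γ ^ 2 * (Λ * |g₁| ^ 3 * σi + |g₁| / (W.ramp * (W.phase j).τ) + Λ * |g₁| ^ 2) ^ 2 / (Λ * Δ ^ 3)) / Λ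
        ≤ Δ)
    (hθo34 : 3 / 4 ≤ Real.exp (-(2 * Λ * (W.phase j).τ * (freqNormSq ℓ / freqNormSq (fun i => (W.phase j).m i * (n : ℤ)) +
              (1 + ε) * σo * (g₁ ^ 2 * (1 - 4 * W.ramp / 3))) +
            40 * β * 2 * Λ * (W.phase j).τ * g₁ ^ 4 * (1 + g₁ ^ 2 * σo ^ 2) / Δ ^ 3 +
            48 * β * 2 * g₁ ^ 2 / (W.ramp * (W.phase j).τ * Λ * Δ ^ 3))))
    (hθi34 : 3 / 4 ≤ Real.exp (-(2 * Λ * (W.phase j).τ * (freqNormSq ℓ / freqNormSq (fun i => (W.phase j).m i * (n : ℤ)) +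
              (1 + ε) * σi * (g₁ ^ 2 * (1 - 4 * W.ramp / 3))) +
            40 * β * γ ^ 2 * Λ * (W.phase j).τ * g₁ ^ 4 * (1 + g₁ ^ 2 * σi ^ 2) / Δ ^ 3 +
            48 * β * γ ^ 2 * g₁ ^ 2 / (W.ramp * (W.phase j).τ * Λ * Δ ^ 3))))
    (hθf : max (Real.exp (-(Λ * Δ) * (W.phase j).τ))
      (Real.exp (-(8 * Real.pi ^ 2 * κ * ((n : ℝ) / 2) ^ 2) * (W.phase j).τ)) ≤ 1 / 4)
    (η : ℝ) (hc : 12 * (2 * g₁ ^ 2 * (2 + γ ^ 2) / Δ ^ 2) ≤ η) (hη1 : η ≤ 1) (hβη : β * η ≤ 1 / 2)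
    (hcone : ∑ k ∈ freqBall N, ‖(pvSetup_cell W hn hκ.le ℓ hw₀ hdiv hmean hsupp).galerkinCoeffAt N ((p : ℝ) * W.period + W.start j) k‖ ^ 2 - 2 * ‖(pvSetup_cell W hn hκ.le ℓ hw₀ hdiv hmean hsupp).galerkinCoeffAt N ((p : ℝ) * W.period + W.start j) ℓ‖ ^ 2 ≤ η * ‖(pvSetup_cell W hn hκ.le ℓ hw₀ hdiv hmean hsupp).galerkinCoeffAt N ((p : ℝ) * W.period + W.start j) ℓ‖ ^ 2)
    (hxpos : 0 < ‖(pvSetup_cell W hn hκ.le ℓ hw₀ hdiv hmean hsupp).galerkinCoeffAt N ((p : ℝ) * W.period + W.start j) ℓ‖ ^ 2) :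
    (∑ k ∈ freqBall N, ‖(pvSetup_cell W hn hκ.le ℓ hw₀ hdiv hmean hsupp).galerkinCoeffAt N ((p : ℝ) * W.period + W.start j + (W.phase j).τ) k‖ ^ 2 - 2 * ‖(pvSetup_cell W hn hκ.le ℓ hw₀ hdiv hmean hsupp).galerkinCoeffAt N ((p : ℝ) * W.period + W.start j + (W.phase j).τ) ℓ‖ ^ 2 ≤ η * ‖(pvSetup_cell W hn hκ.le ℓ hw₀ hdiv hmean hsupp).galerkinCoeffAt N ((p : ℝ) * W.period + W.start j + (W.phase j).τ) ℓ‖ ^ 2 ∧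
        0 < ‖(pvSetup_cell W hn hκ.le ℓ hw₀ hdiv hmean hsupp).galerkinCoeffAt N ((p : ℝ) * W.period + W.start j + (W.phase j).τ) ℓ‖ ^ 2) ∧
    (‖(pvSetup_cell W hn hκ.le ℓ hw₀ hdiv hmean hsupp).galerkinCoeffAt N ((p : ℝ) * W.period + W.start j) ℓ‖ ^ 2 = ‖inner ℂ (WithLp.toLp 2 (Complex.ofReal ∘ ζr) : EuclideanSpace ℂ (Fin 3)) ((pvSetup_cell W hn hκ.le ℓ hw₀ hdiv hmean hsupp).galerkinCoeffAt N ((p : ℝ) * W.period + W.start j) ℓ)‖ ^ 2 + ‖inner ℂ (WithLp.toLp 2 (Complex.ofReal ∘ pf 0) : EuclideanSpace ℂ (Fin 3)) ((pvSetup_cell W hn hκ.le ℓ hw₀ hdiv hmean hsupp).galerkinCoeffAt N ((p : ℝ) * W.period + W.start j) ℓ)‖ ^ 2 ∧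
      Real.log (‖(pvSetup_cell W hn hκ.le ℓ hw₀ hdiv hmean hsupp).galerkinCoeffAt N ((p : ℝ) * W.period + W.start j) ℓ‖ ^ 2) +
          (‖inner ℂ (WithLp.toLp 2 (Complex.ofReal ∘ ζr) : EuclideanSpace ℂ (Fin 3)) ((pvSetup_cell W hn hκ.le ℓ hw₀ hdiv hmean hsupp).galerkinCoeffAt N ((p : ℝ) * W.period + W.start j) ℓ)‖ ^ 2 / ‖(pvSetup_cell W hn hκ.le ℓ hw₀ hdiv hmean hsupp).galerkinCoeffAt N ((p : ℝ) * W.period + W.start j) ℓ‖ ^ 2 * Real.log (Real.exp (-(2 * Λ * (W.phase j).τ * (freqNormSq ℓ / freqNormSq (fun i => (W.phase j).m i * (n : ℤ)) +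
              (1 + ε) * σo * (g₁ ^ 2 * (1 - 4 * W.ramp / 3))) +
            40 * β * 2 * Λ * (W.phase j).τ * g₁ ^ 4 * (1 + g₁ ^ 2 * σo ^ 2) / Δ ^ 3 +
            48 * β * 2 * g₁ ^ 2 / (W.ramp * (W.phase j).τ * Λ * Δ ^ 3)))) +
            ‖inner ℂ (WithLp.toLp 2 (Complex.ofReal ∘ pf 0) : EuclideanSpace ℂ (Fin 3)) ((pvSetup_cell W hn hκ.le ℓ hw₀ hdiv hmean hsupp).galerkinCoeffAt N ((p : ℝ) * W.period + W.start j) ℓ)‖ ^ 2 / ‖(pvSetup_cell W hn hκ.le ℓ hw₀ hdiv hmean hsupp).galerkinCoeffAt N ((p : ℝ) * W.period + W.start j) ℓ‖ ^ 2 * Real.log (Real.exp (-(2 * Λ * (W.phase j).τ * (freqNormSq ℓ / freqNormSq (fun i => (W.phase j).m i * (n : ℤ)) +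
              (1 + ε) * σi * (g₁ ^ 2 * (1 - 4 * W.ramp / 3))) +
            40 * β * γ ^ 2 * Λ * (W.phase j).τ * g₁ ^ 4 * (1 + g₁ ^ 2 * σi ^ 2) / Δ ^ 3 +
            48 * β * γ ^ 2 * g₁ ^ 2 / (W.ramp * (W.phase j).τ * Λ * Δ ^ 3))))) -
          β * η ≤
        Real.log (‖(pvSetup_cell W hn hκ.le ℓ hw₀ hdiv hmean hsupp).galerkinCoeffAt N ((p : ℝ) * W.period + W.start j + (W.phase j).τ) ℓ‖ ^ 2)) ∧
    (∀ t ∈ Icc ((p : ℝ) * W.period + W.start j) ((p : ℝ) * W.period + W.start j + (W.phase j).τ), ‖(pvSetup_cell W hn hκ.le ℓ hw₀ hdiv hmean hsupp).galerkinCoeffAt N ((p : ℝ) * W.period + W.start j) ℓ‖ ^ 2 / 2 ≤ ‖(pvSetup_cell W hn hκ.le ℓ hw₀ hdiv hmean hsupp).galerkinCoeffAt N t ℓ‖ ^ 2) ∧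
    ‖((Real.exp (κ * (4 * Real.pi ^ 2 * freqNormSq ℓ) * (W.phase j).τ) : ℝ) : ℂ) • (pvSetup_cell W hn hκ.le ℓ hw₀ hdiv hmean hsupp).galerkinCoeffAt N ((p : ℝ) * W.period + W.start j + (W.phase j).τ) ℓ - (pvSetup_cell W hn hκ.le ℓ hw₀ hdiv hmean hsupp).galerkinCoeffAt N ((p : ℝ) * W.period + W.start j) ℓ‖ ≤
      Real.exp (κ * (4 * Real.pi ^ 2 * freqNormSq ℓ) * (W.phase j).τ) *
        (Λ * |g₁| * (Real.sqrt 2 + γ) * Real.sqrt (η * ‖(pvSetup_cell W hn hκ.le ℓ hw₀ hdiv hmean hsupp).galerkinCoeffAt N ((p : ℝ) * W.period + W.start j) ℓ‖ ^ 2)) * (W.phase j).τ := by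
  classical
  set hPV := pvSetup_cell W hn hκ.le ℓ hw₀ hdiv hmean hsupp with hPVdef
  have hτ : 0 < (W.phase j).τ := (W.phase j).τ_pos
  have HL := sector_slot_lower W hn hκ ℓ hw₀ hdiv hmean hsupp hBN p j hT hk hdisj hζ1 hζ0 hζK hp hW h0 h1 hm1 hs Λ Δ ε β σo
    σi g₁ γ hΛ hΔ0 hε hβ hgap hσo hσi hγ hγ0 hg₁ hβo hβi hsmallo hsmalli
  have HC := sector_slot_cone W hn hκ ℓ hℓn hw₀ hdiv hmean hsupp hBN p j hT hk hdisj hζ1 hζ0 hζK hp hW h0 h1 hm1 hs Λ Δ ε β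
    σo σi g₁ γ hΛ hΔ0 hε hβ hgap hσo hσi hγ hγ0 hg₁ hβo hβi hsmallo hsmalli
  -- names for the numbers involved
  obtain ⟨xa, hxa⟩ : ∃ r : ℝ, r = ‖hPV.galerkinCoeffAt N ((p : ℝ) * W.period + W.start j) ℓ‖ ^ 2 := ⟨_, rfl⟩
  obtain ⟨xb, hxb⟩ : ∃ r : ℝ, r = ‖hPV.galerkinCoeffAt N ((p : ℝ) * W.period + W.start j + (W.phase j).τ) ℓ‖ ^ 2 := ⟨_, rfl⟩
  obtain ⟨Ea, hEa⟩ : ∃ r : ℝ, r = ∑ k ∈ freqBall N, ‖hPV.galerkinCoeffAt N ((p : ℝ) * W.period + W.start j) k‖ ^ 2 := ⟨_, rfl⟩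
  obtain ⟨Eb, hEb⟩ : ∃ r : ℝ, r = ∑ k ∈ freqBall N, ‖hPV.galerkinCoeffAt N ((p : ℝ) * W.period + W.start j + (W.phase j).τ) k‖ ^ 2 := ⟨_, rfl⟩
  obtain ⟨Eo, hEo⟩ : ∃ r : ℝ, r = ‖inner ℂ (WithLp.toLp 2 (Complex.ofReal ∘ ζr) : EuclideanSpace ℂ (Fin 3)) (hPV.galerkinCoeffAt N ((p : ℝ) * W.period + W.start j) ℓ)‖ ^ 2 := ⟨_, rfl⟩
  obtain ⟨Ei, hEi⟩ : ∃ r : ℝ, r = ‖inner ℂ (WithLp.toLp 2 (Complex.ofReal ∘ pf 0) : EuclideanSpace ℂ (Fin 3)) (hPV.galerkinCoeffAt N ((p : ℝ) * W.period + W.start j) ℓ)‖ ^ 2 := ⟨_, rfl⟩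
  obtain ⟨θo, hθo⟩ : ∃ r : ℝ, r = Real.exp (-(2 * Λ * (W.phase j).τ * (freqNormSq ℓ / freqNormSq (fun i => (W.phase j).m i * (n : ℤ)) +
              (1 + ε) * σo * (g₁ ^ 2 * (1 - 4 * W.ramp / 3))) +
            40 * β * 2 * Λ * (W.phase j).τ * g₁ ^ 4 * (1 + g₁ ^ 2 * σo ^ 2) / Δ ^ 3 +
            48 * β * 2 * g₁ ^ 2 / (W.ramp * (W.phase j).τ * Λ * Δ ^ 3))) := ⟨_, rfl⟩
  obtain ⟨θi, hθi⟩ : ∃ r : ℝ, r = Real.exp (-(2 * Λ * (W.phase j).τ * (freqNormSq ℓ / freqNormSq (fun i => (W.phase j).m i * (n : ℤ)) +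
              (1 + ε) * σi * (g₁ ^ 2 * (1 - 4 * W.ramp / 3))) +
            40 * β * γ ^ 2 * Λ * (W.phase j).τ * g₁ ^ 4 * (1 + g₁ ^ 2 * σi ^ 2) / Δ ^ 3 +
            48 * β * γ ^ 2 * g₁ ^ 2 / (W.ramp * (W.phase j).τ * Λ * Δ ^ 3))) := ⟨_, rfl⟩
  obtain ⟨c, hcdef⟩ : ∃ r : ℝ, r = 2 * g₁ ^ 2 * (2 + γ ^ 2) / Δ ^ 2 := ⟨_, rfl⟩
  rw [← hxa, ← hEa] at hcone
  rw [← hxa] at hxpos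
  rw [← hθo] at hθo34
  rw [← hθi] at hθi34
  rw [← hcdef] at hc
  obtain ⟨hsplit', hlow, _⟩ := HL
  obtain ⟨hfastE, hfastI⟩ := HC
  have hsplit : xa = Eo + Ei := by rw [hxa, hEo, hEi]; exact hsplit' _
  have hbmem : ((p : ℝ) * W.period + W.start j + (W.phase j).τ) ∈ Icc ((p : ℝ) * W.period + W.start j) ((p : ℝ) * W.period + W.start j + (W.phase j).τ) := ⟨by linarith, le_rfl⟩
  have hlowb : θo * Eo + θi * Ei - β / 2 * (Ea - 2 * xa) ≤ xb := by
    have h := hlow _ hbmem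
    rw [← hθo, ← hθi, ← hEo, ← hEi, ← hEa, ← hxa, ← hxb] at h
    exact h
  have hfast : Eb - 2 * xb ≤ 1 / 4 * (Ea - 2 * xa) + c * Ea := by
    rw [← hEb, ← hxb, ← hEa, ← hxa, ← hcdef] at hfastE
    have hRa0 : 0 ≤ Ea - 2 * xa := by
      -- the principal pair lies in the ball
      have hℓS : ℓ ∈ freqBall N := by have := (hW 0).1 h0; simpa using this
      have hℓS' : -ℓ ∈ freqBall N := neg_mem_freqBall_of_mem _ hℓS
      have hℓne : ℓ ≠ -ℓ := by have := hdisj 0 0; simpa using this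
      have hsub : ({ℓ, -ℓ} : Finset (Fin 3 → ℤ)) ⊆ freqBall N := by
        intro k hk'
        simp only [Finset.mem_insert, Finset.mem_singleton] at hk'
        rcases hk' with rfl | rfl
        · exact hℓS
        · exact hℓS'
      have h := Finset.sum_le_sum_of_subset_of_nonneg hsub (fun k _ _ => sq_nonneg ‖hPV.galerkinCoeffAt N ((p : ℝ) * W.period + W.start j) k‖)
      rw [Finset.sum_pair hℓne, norm_galerkinCoeffAt_neg W hn hκ.le ℓ hw₀ hdiv hmean hsupp] at h
      rw [hEa, hxa]; linarith
    have hm := mul_le_mul_of_nonneg_right hθf hRa0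
    linarith
  -- the one-slot arithmetic
  have hEo0 : 0 ≤ Eo := by rw [hEo]; positivity
  have hEi0 : 0 ≤ Ei := by rw [hEi]; positivity
  have hθo1 : θo ≤ 1 := by
    rw [hθo]; refine Real.exp_le_one_iff.2 (neg_nonpos.2 ?_)
    have hΛ0 : 0 < Λ := by rw [hΛ]; exact cellRate_pos (W.phase j) hn hκ
    have h4 : 0 ≤ freqNormSq ℓ / freqNormSq (fun i => (W.phase j).m i * (n : ℤ)) := div_nonneg (freqNormSq_nonneg _) (freqNormSq_nonneg _)
    have hρ3 : 0 ≤ 1 - 4 * W.ramp / 3 := by have := W.ramp_le; linarith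
    have hσo0 : 0 ≤ σo := by
      by_contra hneg
      push Not at hneg
      have : β * Δ * ε * σo ≤ 0 := mul_nonpos_of_nonneg_of_nonpos (by positivity) hneg.le
      linarith
    have h3 := W.ramp_pos
    generalize freqNormSq ℓ / freqNormSq (fun i => (W.phase j).m i * (n : ℤ)) = d0 at h4 ⊢
    generalize 1 - 4 * W.ramp / 3 = ρ' at hρ3 ⊢
    positivity
  have hθi1 : θi ≤ 1 := by
    rw [hθi]; refine Real.exp_le_one_iff.2 (neg_nonpos.2 ?_)
    have hΛ0 : 0 < Λ := by rw [hΛ]; exact cellRate_pos (W.phase j) hn hκ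
    have h4 : 0 ≤ freqNormSq ℓ / freqNormSq (fun i => (W.phase j).m i * (n : ℤ)) := div_nonneg (freqNormSq_nonneg _) (freqNormSq_nonneg _)
    have hρ3 : 0 ≤ 1 - 4 * W.ramp / 3 := by have := W.ramp_le; linarith
    have hgp : Δ ≤ freqNormSq (ℓ + (1 : ℤ) • (fun i => (W.phase j).m i * (n : ℤ))) / freqNormSq (fun i => (W.phase j).m i * (n : ℤ)) - freqNormSq ℓ / freqNormSq (fun i => (W.phase j).m i * (n : ℤ)) := by
      have := hgap 1 h1 one_ne_zero; linarith
    have hgm : Δ ≤ freqNormSq (ℓ + (-1 : ℤ) • (fun i => (W.phase j).m i * (n : ℤ))) / freqNormSq (fun i => (W.phase j).m i * (n : ℤ)) - freqNormSq ℓ / freqNormSq (fun i => (W.phase j).m i * (n : ℤ)) := by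
      have := hgap (-1) hm1 (by norm_num); linarith
    have hσi0 : 0 ≤ σi := by
      rw [hσi]
      exact add_nonneg (div_nonneg (sq_nonneg _) (hΔ0.le.trans hgm)) (div_nonneg (sq_nonneg _) (hΔ0.le.trans hgp))
    have h3 := W.ramp_pos
    generalize freqNormSq ℓ / freqNormSq (fun i => (W.phase j).m i * (n : ℤ)) = d0 at h4 ⊢
    generalize 1 - 4 * W.ramp / 3 = ρ' at hρ3 ⊢
    positivity
  obtain ⟨wo, hwo⟩ : ∃ r : ℝ, r = Eo / xa := ⟨_, rfl⟩
  obtain ⟨wi, hwi⟩ : ∃ r : ℝ, r = Ei / xa := ⟨_, rfl⟩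
  have hwo0 : 0 ≤ wo := by rw [hwo]; exact div_nonneg hEo0 hxpos.le
  have hwi0 : 0 ≤ wi := by rw [hwi]; exact div_nonneg hEi0 hxpos.le
  have hwsum : wo + wi = 1 := by rw [hwo, hwi, ← add_div, ← hsplit, div_self hxpos.ne']
  obtain ⟨θb, hθb⟩ : ∃ r : ℝ, r = wo * θo + wi * θi := ⟨_, rfl⟩
  have hθbx : θb * xa = θo * Eo + θi * Ei := by
    rw [hθb, hwo, hwi]; field_simp
  have hθb1 : 3 / 4 ≤ θb := by
    have t1 := mul_le_mul_of_nonneg_left hθo34 hwo0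
    have t2 := mul_le_mul_of_nonneg_left hθi34 hwi0
    rw [hθb]; linarith
  have hθb2 : θb ≤ 1 := by
    have t1 := mul_le_mul_of_nonneg_left hθo1 hwo0
    have t2 := mul_le_mul_of_nonneg_left hθi1 hwi0
    rw [hθb]; linarith
  have hc0 : 0 ≤ c := by rw [hcdef]; positivity
  have hη0 : 0 ≤ η := by linarith
  have hRa : Ea - 2 * xa ≤ η * xa := hcone
  have hβη0 : 0 ≤ β * η := mul_nonneg hβ hη0
  have hηx : η * xa ≤ xa := by have := mul_le_mul_of_nonneg_right hη1 hxpos.le; linarith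
  have hEa3 : Ea ≤ 3 * xa := by linarith
  have hβR : β / 2 * (Ea - 2 * xa) ≤ β / 2 * (η * xa) := mul_le_mul_of_nonneg_left hRa (by positivity)
  have hβηx : β * η / 2 * xa ≤ 1 / 4 * xa := by have := mul_le_mul_of_nonneg_right hβη hxpos.le; linarith
  have hθbxa : 3 / 4 * xa ≤ θb * xa := mul_le_mul_of_nonneg_right hθb1 hxpos.le
  -- slow lower step and positivity
  have hx1 : (θb - β * η / 2) * xa ≤ xb := by
    have e : (θb - β * η / 2) * xa = θb * xa - β / 2 * (η * xa) := by ring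
    rw [e]; linarith
  have hhalf : xa / 2 ≤ xb := by
    have e : (θb - β * η / 2) * xa = θb * xa - β * η / 2 * xa := by ring
    rw [e] at hx1; linarith
  have hxbpos : 0 < xb := by linarith
  refine ⟨⟨?_, by rw [← hxb]; exact hxbpos⟩, ⟨by rw [← hxa, ← hEo, ← hEi]; exact hsplit, ?_⟩, ?_, ?_⟩
  · -- the cone propagates
    rw [← hEb, ← hxb]
    have q1 : 1 / 4 * (Ea - 2 * xa) ≤ 1 / 4 * (η * xa) := by linarith
    have p1 : c * Ea ≤ c * (3 * xa) := mul_le_mul_of_nonneg_left hEa3 hc0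
    have p3 : 12 * c * xa ≤ η * xa := mul_le_mul_of_nonneg_right hc hxpos.le
    have p4 : η * (xa / 2) ≤ η * xb := mul_le_mul_of_nonneg_left hhalf hη0
    linarith
  · -- the log step
    rw [← hxa, ← hxb, ← hEo, ← hEi, ← hθo, ← hθi]
    have hfac : 0 < θb - β * η / 2 := by linarith
    have hlog1 : Real.log ((θb - β * η / 2) * xa) ≤ Real.log xb := Real.log_le_log (mul_pos hfac hxpos) hx1
    rw [Real.log_mul hfac.ne' hxpos.ne'] at hlog1
    have hlog2 := log_sub_ge (u := β * η / 2) (by linarith : 0 < θb) (by linarith)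
    have hlog3 : β * η / 2 / (θb - β * η / 2) ≤ β * η := by
      rw [div_le_iff₀ hfac]
      -- `βη/2 ≤ βη(θb − βη/2)` since `θb − βη/2 ≥ 1/2`
      have h12 : 1 / 2 ≤ θb - β * η / 2 := by linarith
      have := mul_le_mul_of_nonneg_left h12 hβη0
      linarith
    have hj := log_two_point_jensen hwo0 hwi0 hwsum (by linarith : 0 < θo) (by linarith : 0 < θi)
    rw [← hθb] at hj
    have e : Eo / xa * Real.log θo + Ei / xa * Real.log θi = wo * Real.log θo + wi * Real.log θi := by rw [hwo, hwi]
    rw [e]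
    linarith
  · -- interior
    intro t ht
    have h := hlow t ht
    rw [← hθo, ← hθi, ← hEo, ← hEi, ← hEa, ← hxa] at h
    rw [← hxa]
    have : xa / 2 ≤ θo * Eo + θi * Ei - β / 2 * (Ea - 2 * xa) := by linarith
    exact this.trans h
  · -- drift
    have hZ : ∀ t ∈ Icc ((p : ℝ) * W.period + W.start j) ((p : ℝ) * W.period + W.start j + (W.phase j).τ),
        ∑ J ∈ Wset.erase 0, (‖inner ℂ (WithLp.toLp 2 (Complex.ofReal ∘ ζr) : EuclideanSpace ℂ (Fin 3)) (hPV.galerkinCoeffAt N t (ℓ + J • (fun i => (W.phase j).m i * (n : ℤ))))‖ ^ 2 +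
          ‖inner ℂ (WithLp.toLp 2 (Complex.ofReal ∘ pf J) : EuclideanSpace ℂ (Fin 3))
            (hPV.galerkinCoeffAt N t (ℓ + J • (fun i => (W.phase j).m i * (n : ℤ))))‖ ^ 2) ≤ η * xa := by
      intro t ht
      refine (hfastI t ht).trans ?_
      rw [← hEa, ← hxa]
      have t1 : g₁ ^ 2 * (2 + γ ^ 2) / Δ ^ 2 = c / 2 := by rw [hcdef]; ring
      rw [t1]
      have p1 : c / 2 * Ea ≤ c / 2 * (3 * xa) := mul_le_mul_of_nonneg_left hEa3 (by positivity)
      have p3 : 12 * c * xa ≤ η * xa := mul_le_mul_of_nonneg_right hc hxpos.le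
      have p5 : 0 ≤ η * xa := by positivity
      linarith
    have h := sector_slot_drift W hn hκ ℓ hw₀ hdiv hmean hsupp hBN p j hT hk hζ1 hζ0 hζK hp hW h0 h1 hm1 Λ g₁ γ
      (η * xa) hΛ hγ hγ0 hg₁ hZ ((p : ℝ) * W.period + W.start j + (W.phase j).τ) hbmem
    have e : ((p : ℝ) * W.period + W.start j + (W.phase j).τ) - ((p : ℝ) * W.period + W.start j) = (W.phase j).τ := by ring
    rw [e] at h
    rw [← hxa]
    exact h

end Summit.AnomalousDissipation.AnomalousDissipation.Theorems.SolenoidalFractalHomogenisation.RealisedQuasiStaticCellLaw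

end
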